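import Summits.QuantumFields.YangMills.Theorems.BalabanUVNodesN18KernelStepRateKingMechanismRecord
import Literature.MathematicalPhysics.QuantumFieldTheory.Balaban1983to89.B12Display286RightMember

/-!
# BalabanUVNodes ∕ N18 — KING's THREE-FACTOR MECHANISM ON ℤ⁴ SUMMATION LATTICES: the lattice-sum and pseudo-distance rows DISCHARGED by B12's lattice
# constant `K₁(4, a) = Σ_{z∈ℤ⁴} e^{−a|z|₁}`, and the A2 CALIBRATION of the mechanism's rows against the two letters {(UD), `KernelStepRate`}
# (Track A, DAG node N18 = NE5; key K3⁷ `SpineGivenEndpointR13SepCoPH` stmt-QuantumFields-20544, skeleton v5 941dddb108cbaacf; width seat `pub-ymgap-dag-n18-w4` g2 —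
# FILE 4 of the item-3 lineage `…N18KernelStepRateKingMechanism` (p606901) ∕ `…Record` (p607866) ∕ `…Windowed` (p608767); answers referee ref-Q READ-9 (N2))

HONEST FRAMING.  Count-neutral kernel bookkeeping BY NAME (`--kind proof --supports stmt-QuantumFields-20544 --as helper`).  CALIBRATION AND BOOKKEEPING over tree
definitions: B12's lattice constant `B12Decay510Window.K₁` with `B12Display286RightMember.sum_exp_neg_l1_sub_le`, the ℓ¹ facts `l1_nonneg ∕ l1_sub_triangle`, and FILE 1 ∕ FILE 2's
mechanism theorems.  The three-factor structure `u ⬝ (E v)` WITH k-UNIFORM SIZES AND ONE-LINE RATES of Bałaban's limiting (1.21) kernels is a HYPOTHESIS asserted nowhere (C. King's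
printed MODEL of the mechanism, [King1986] p. 665 and (4.41)–(4.43) p. 675, read at node00-def-W1's kernel objects); NE5 for Bałaban's outputs is NOT PRINTED for d = 4 ([Balaban1987RG1]
Thm 1 p. 259 prints uniformity in the spacing only) and is NOT proved here; N18 ∕ (D4) NOT discharged; (5.10) NOT discharged; K3⁷ OPEN, not claimed; counts UNMOVED (typed 28∕28 ·
discharged 5∕28).  One finite four-torus programme at fixed `ε`, Bałaban AS PRINTED; R4 closes the conditional finite-𝕋⁴ rung `BalabanLadder.UV` only — NOT ℝ⁴, NOT infinite volume, NOT
OS, NOT a mass gap, NOT Clay.  THEOREMS ONLY: 0 `def`, 0 `sorry`, standard axioms.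

WHY.  FILE 1 §2 (`kernelStepRate_of_threeFactorRates`) carries, besides the factor rows, three GEOMETRIC rows — a pseudo-distance `ρd k` on an abstract position type (`hρ0`,
`hρtri`) and k-UNIFORM lattice sums `∑_i e^{−(κ∕2)ρd(s, q i)} ≤ V` (`hV`) — and its A2 status (№189) was «inhabited trivially (zero family)» (ref-Q READ-9 (N2): «no non-trivial A2
witness of the three-factor hypotheses at kernel level»).  The (1.21) kernels are ℤ⁴-indexed and King's (4.42) sums run over lattice sites: with positions IN ℤ⁴ and ℓ¹ separations
the geometric rows are THEOREMS — the sums by [Balaban1987RG1]'s own lattice constant `K₁` ((5.10) p. 293 bookkeeping, the tree's `B12Decay510Window.cubeSumLeaf` ∕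
`B12Display286RightMember.sum_exp_neg_l1_sub_le`), uniformly in the window AND the level.  And on ℤ⁴ lattices the rows CALIBRATE: every family that carries the (UD) letter and the
N18 letter inhabits ALL of them at the one-point lattice (the kernel itself as the row factor), the mechanism handing the letter back at rate `κ∕2` — so the eleven rows are jointly
satisfiable by NON-ZERO kernels exactly when the two letters hold, and the road's located cost is the factorisation with k-uniform sizes, nothing hidden in the geometry.

WHAT.
* §7 ℤᵈ LATTICE SUMS: `sum_exp_neg_l1_sub_le_mul_K₁_of_card_fiber_le` — for a finite index type read in ℤᵈ through `q` with fibres of size `≤ m` (internal indices allowed),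
  `∑_i e^{−a|s − q i|₁} ≤ m·K₁(d, a)` for every `s`, `a > 0`; `sum_exp_neg_l1_sub_le_K₁_of_injective` — injective `q`: `≤ K₁(d, a)`.  Uniform in the index set.
* §8 THE MECHANISM ON ℤ⁴ LATTICES (generic term family `ℰ`): ★ `kernelStepRate_of_threeFactorRates_zlattice` — FILE 1 §2 with summation lattices `q k : β k ↪ ℤ⁴`, read positions
  `p, r ∈ ℤ⁴` with `|z|₁ ≤ |p − r|₁`, decay `e^{−κ|·−·|₁}` through positions, `κ > 0`; NO pseudo-distance rows, NO lattice-sum row ⟹ `KernelStepRate F ℰ ρ bV γ (κ∕2) θ₅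
  ((cA·sC·sB + sA·cC·sB + sA·sC·cB)·K₁(4, κ∕2)²)`; ★ `decayBound_EA_of_threeFactorSizes_zlattice` ∕ `kernelDecay_of_threeFactorSizes_zlattice` — run A's SIZES ⟹ (UD)
  `DecayBound (EA F ℰ ρ bV) (Window γ) (sA·sC·sB·K₁(4, κ∕2)²) (κ∕2)` and the (5.10) class letter.
* §9 A2 CALIBRATION: ★ `kernelStepRate_of_letters_via_threeFactorRows` — (UD) `DecayBound (EA F ℰ ρ bV) (Window γ) E₀ κ` + `KernelStepRate F ℰ ρ bV γ κ θ₅ C₅` INHABIT every row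
  of §8 at `β k = Unit`, `q = 0`, `p = z`, `r = 0`, `u_A = Π_{k+1}(g; z)`, `u_B = Π_{k+2}(b, g; z)`, `E = v = 1`, sizes `(E₀, 1, 1)`, rates `(C₅, 0, 0)`; the mechanism returns
  `KernelStepRate F ℰ ρ bV γ (κ∕2) θ₅ (C₅·K₁(4, κ∕2)²)` (the PROOF is the inhabitant: each row discharged in one line).
* §10 AT THE RECORD: `kernelStepRateOfRecord₁₃_of_threeFactorRates_zlattice` ∕ `kernelDecayOfRecord₁₃_of_threeFactorSizes_zlattice` — FILE 2 §4's record editions on ℤ⁴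
  lattices (the rows the v5 pin's N18 conjunct and the (D4) read-out consume, dag-n18-w1 p597580 ∕ dag-n27-w1 p591653, with the geometry discharged).

Sources (TYPES, the mechanism and the lattice constant only): C. King, Commun. Math. Phys. **102** (1986) 649–677 [King1986] — Prop. 3.9 (3.73) p. 665, (4.41)–(4.43) p. 675
(«Σ_{b} e^{−δ|x−b|}e^{−δ|b−y|} ≤ c e^{−δ′|x−y|}» lattice sums); T. Bałaban, Commun. Math. Phys. **109** (1987) 249–301 [Balaban1987RG1] — Thm 1 p. 259 (the window), (1.18) p. 263,
(1.20)–(1.22) p. 264 (ℤ⁴-indexed kernels after «T^{(k+1)} ↗ Z^d»), (4.22) p. 286 and (5.10) p. 293 (the lattice sums `Σ_z e^{−a|z|₁}`).  No claim about the mass gap.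
-/

noncomputable section

namespace YMDAG.N18.KernelStepRateKingMechanism

open scoped BigOperators
open Matrix
open Literature.MathematicalPhysics.QuantumFieldTheory.Balaban1983to89
open Literature.MathematicalPhysics.QuantumFieldTheory.Balaban1983to89.T4Continuum (T4Family)
open Literature.MathematicalPhysics.QuantumFieldTheory.Balaban1983to89.T4OutputRate (Window DecayBound)
open Literature.MathematicalPhysics.QuantumFieldTheory.Balaban1983to89.B12Sec2to5 (l1 l1_nonneg)
open Literature.MathematicalPhysics.QuantumFieldTheory.Balaban1983to89.B12Decay510Window (K₁ K₁_nonneg l1_sub_triangle l1_sub_comm)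
open Literature.MathematicalPhysics.QuantumFieldTheory.Balaban1983to89.B12Display286RightMember (sum_exp_neg_l1_sub_le)
open Node00 (U3Letters₁₁ Stage13Params TermFamily1 prependCoupling)
open Node00.U3OfKernels (kernelA EA KernelDecay pt bg objectsOfRecord₁₃ KernelDecayOfRecord₁₃ decayBound_EA_iff)
open Node00.U3KernelLetters (KernelStepRate KernelStepRateOfRecord₁₃)

/-! ## §7 ℤᵈ lattice sums: the row `hV` of the mechanism, uniformly in the index set, by B12's lattice constant `K₁(d, a)` -/

section LatticeSums

variable {d : ℕ}

/-- **LATTICE SUMS THROUGH A FINITE-FIBRE READING IN ℤᵈ**: if the finite index type `β` is read in `ℤᵈ` by `q` with at most `m` indices per site (internal indices — directions,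
colours — allowed), then for every site `s` and every rate `a > 0`, `∑_i e^{−a|s − q i|₁} ≤ m·K₁(d, a)` with B12's lattice constant `K₁(d, a) = Σ_{z∈ℤᵈ} e^{−a|z|₁}` — UNIFORMLY in
`β` (the row `hV` of King's (4.41)∕(4.43) lattice sums for ℤᵈ-indexed kernels). [cite: Balaban1987RG1, (4.22) p.286 and (5.10) p.293; King1986, (4.41) p.675] -/
theorem sum_exp_neg_l1_sub_le_mul_K₁_of_card_fiber_le {β : Type*} [Fintype β] (q : β → (Fin d → ℤ)) {m : ℕ}
    (hq : ∀ x : Fin d → ℤ, (Finset.univ.filter fun i => q i = x).card ≤ m) (s : Fin d → ℤ) {a : ℝ} (ha : 0 < a) :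
    ∑ i, Real.exp (-(a * l1 (s - q i))) ≤ m * K₁ d a := by
  classical
  have hcomp := Finset.sum_comp (s := (Finset.univ : Finset β)) (fun x : Fin d → ℤ => Real.exp (-(a * l1 (s - x)))) q
  rw [hcomp]
  calc ∑ x ∈ Finset.univ.image q, (Finset.univ.filter fun i => q i = x).card • Real.exp (-(a * l1 (s - x)))
      ≤ ∑ x ∈ Finset.univ.image q, (m : ℝ) * Real.exp (-(a * l1 (x - s))) :=
        Finset.sum_le_sum fun x _ => by
          rw [nsmul_eq_mul, l1_sub_comm]
          exact mul_le_mul_of_nonneg_right (Nat.cast_le.mpr (hq x)) (Real.exp_pos _).le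
    _ = m * ∑ x ∈ Finset.univ.image q, Real.exp (-(a * l1 (x - s))) := by rw [Finset.mul_sum]
    _ ≤ m * K₁ d a := mul_le_mul_of_nonneg_left (sum_exp_neg_l1_sub_le _ s ha) (Nat.cast_nonneg m)

/-- **LATTICE SUMS OVER A FINITE WINDOW OF ℤᵈ**: an injective reading `q : β ↪ ℤᵈ` (a finite window of sites) has `∑_i e^{−a|s − q i|₁} ≤ K₁(d, a)` for every site `s` and
rate `a > 0`, uniformly in the window. [cite: Balaban1987RG1, (4.22) p.286 and (5.10) p.293; King1986, (4.41) p.675] -/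
theorem sum_exp_neg_l1_sub_le_K₁_of_injective {β : Type*} [Fintype β] (q : β → (Fin d → ℤ)) (hq : Function.Injective q)
    (s : Fin d → ℤ) {a : ℝ} (ha : 0 < a) : ∑ i, Real.exp (-(a * l1 (s - q i))) ≤ K₁ d a := by
  classical
  have h := sum_exp_neg_l1_sub_le_mul_K₁_of_card_fiber_le q (m := 1) (fun x => ?_) s ha
  · simpa using h
  · refine Finset.card_le_one.mpr fun i hi j hj => hq ?_
    rw [Finset.mem_filter] at hi hj
    rw [hi.2, hj.2]

end LatticeSums

/-! ## §8 The mechanism on ℤ⁴ summation lattices: the three geometric rows discharged -/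

section ZLattice

variable {𝔄 : Type*} [NormedRing 𝔄] [NormedAlgebra ℝ 𝔄]
variable {V𝔳 : Type*} [NormedAddCommGroup V𝔳] [NormedSpace ℝ V𝔳] {ι : Type*} [Fintype ι]
variable (F : T4Family) (ℰ : TermFamily1 F 𝔄) (ρ : V𝔳 →L[ℝ] 𝔄) (bV : Module.Basis ι ℝ V𝔳)
variable {β : ℕ → Type*} [∀ k, Fintype (β k)]

/-- ★ **KING's MECHANISM ON ℤ⁴ LATTICES PRODUCES THE N18 LETTER — geometry discharged.**  If, on the window `]0, γ]^ℕ`, run A's limiting level-`(k+1)` kernel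
`Π_{k+1,μν}(g; z)` and run B's re-indexed `Π_{k+2,μν}(b, g; z)` are three-factor read-outs `u ⬝ (E v)` over a level-`k` summation lattice `β k` READ IN ℤ⁴ by an injective
`q k` (a finite window of sites), with read positions `p, r ∈ ℤ⁴` of the entry at ℓ¹ separation `≥ |z|₁`, sizes `sA, sC, sB`, ONE-LINE RATES `cA·θ₅^{k+1}, cC·θ₅^{k+1}, cB·θ₅^{k+1}`
and ℓ¹ decay `κ > 0` through the positions, then `KernelStepRate F ℰ ρ bV γ (κ∕2) θ₅ ((cA·sC·sB + sA·cC·sB + sA·sC·cB)·K₁(4, κ∕2)²)` — FILE 1 §2 with its pseudo-distance rows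
discharged by `l1_nonneg ∕ l1_sub_triangle` and its lattice-sum row by §7 (`V = K₁(4, κ∕2)`, uniform in the window and the level).
[cite: King1986, Prop. 3.9 (3.73) p.665 and (4.41)–(4.43) p.675; Balaban1987RG1, Thm 1 p.259, (1.20)–(1.22) p.264 and (5.10) p.293] -/
theorem kernelStepRate_of_threeFactorRates_zlattice
    (q : (k : ℕ) → β k → (Fin 4 → ℤ)) (hq : ∀ k, Function.Injective (q k)) (p r : (k : ℕ) → Fin 4 → Fin 4 → (Fin 4 → ℤ) → (Fin 4 → ℤ))
    (uA vA : (ℕ → ℝ) → (k : ℕ) → Fin 4 → Fin 4 → (Fin 4 → ℤ) → β k → ℝ)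
    (CA : (ℕ → ℝ) → (k : ℕ) → Fin 4 → Fin 4 → (Fin 4 → ℤ) → Matrix (β k) (β k) ℝ)
    (uB vB : ℝ → (ℕ → ℝ) → (k : ℕ) → Fin 4 → Fin 4 → (Fin 4 → ℤ) → β k → ℝ)
    (CB : ℝ → (ℕ → ℝ) → (k : ℕ) → Fin 4 → Fin 4 → (Fin 4 → ℤ) → Matrix (β k) (β k) ℝ)
    {γ κ θ₅ sA sC sB cA cC cB : ℝ} (hκ : 0 < κ) (hθ : 0 ≤ θ₅) (hsA : 0 ≤ sA) (hsC : 0 ≤ sC) (hsB : 0 ≤ sB)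
    (hcA : 0 ≤ cA) (hcC : 0 ≤ cC) (hcB : 0 ≤ cB)
    (hEA : ∀ g ∈ Window γ, ∀ (k : ℕ) (μ ν : Fin 4) (z : Fin 4 → ℤ),
      kernelA F ℰ ρ bV g k μ ν z = uA g k μ ν z ⬝ᵥ (CA g k μ ν z *ᵥ vA g k μ ν z))
    (hEB : ∀ b : ℝ, 0 < b → b ≤ γ → ∀ g ∈ Window γ, ∀ (k : ℕ) (μ ν : Fin 4) (z : Fin 4 → ℤ),
      kernelA F ℰ ρ bV (prependCoupling b g) (k + 1) μ ν z = uB b g k μ ν z ⬝ᵥ (CB b g k μ ν z *ᵥ vB b g k μ ν z))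
    (hu : ∀ g ∈ Window γ, ∀ (k : ℕ) (μ ν : Fin 4) (z : Fin 4 → ℤ) (i : β k),
      |uA g k μ ν z i| ≤ sA * Real.exp (-(κ * l1 (p k μ ν z - q k i))))
    (hCA : ∀ g ∈ Window γ, ∀ (k : ℕ) (μ ν : Fin 4) (z : Fin 4 → ℤ) (i i' : β k),
      |CA g k μ ν z i i'| ≤ sC * Real.exp (-(κ * l1 (q k i - q k i'))))
    (hCB : ∀ b : ℝ, 0 < b → b ≤ γ → ∀ g ∈ Window γ, ∀ (k : ℕ) (μ ν : Fin 4) (z : Fin 4 → ℤ) (i i' : β k),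
      |CB b g k μ ν z i i'| ≤ sC * Real.exp (-(κ * l1 (q k i - q k i'))))
    (hv : ∀ b : ℝ, 0 < b → b ≤ γ → ∀ g ∈ Window γ, ∀ (k : ℕ) (μ ν : Fin 4) (z : Fin 4 → ℤ) (i' : β k),
      |vB b g k μ ν z i'| ≤ sB * Real.exp (-(κ * l1 (q k i' - r k μ ν z))))
    (hdu : ∀ b : ℝ, 0 < b → b ≤ γ → ∀ g ∈ Window γ, ∀ (k : ℕ) (μ ν : Fin 4) (z : Fin 4 → ℤ) (i : β k),
      |uB b g k μ ν z i - uA g k μ ν z i| ≤ cA * θ₅ ^ (k + 1) * Real.exp (-(κ * l1 (p k μ ν z - q k i))))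
    (hdC : ∀ b : ℝ, 0 < b → b ≤ γ → ∀ g ∈ Window γ, ∀ (k : ℕ) (μ ν : Fin 4) (z : Fin 4 → ℤ) (i i' : β k),
      |CB b g k μ ν z i i' - CA g k μ ν z i i'| ≤ cC * θ₅ ^ (k + 1) * Real.exp (-(κ * l1 (q k i - q k i'))))
    (hdv : ∀ b : ℝ, 0 < b → b ≤ γ → ∀ g ∈ Window γ, ∀ (k : ℕ) (μ ν : Fin 4) (z : Fin 4 → ℤ) (i' : β k),
      |vB b g k μ ν z i' - vA g k μ ν z i'| ≤ cB * θ₅ ^ (k + 1) * Real.exp (-(κ * l1 (q k i' - r k μ ν z))))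
    (hd : ∀ (k : ℕ) (μ ν : Fin 4) (z : Fin 4 → ℤ), l1 z ≤ l1 (p k μ ν z - r k μ ν z)) :
    KernelStepRate F ℰ ρ bV γ (κ / 2) θ₅ ((cA * sC * sB + sA * cC * sB + sA * sC * cB) * K₁ 4 (κ / 2) ^ 2) :=
  kernelStepRate_of_threeFactorRates F ℰ ρ bV (P := fun _ => Fin 4 → ℤ) (fun _ x y => l1 (x - y)) (fun _ _ _ => l1_nonneg _)
    (fun _ x y w => l1_sub_triangle x y w) q p r uA vA CA uB vB CB hκ.le hθ hsA hsC hsB hcA hcC hcB hEA hEB hu hCA hCB hv hdu hdC hdv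
    (fun k s => sum_exp_neg_l1_sub_le_K₁_of_injective (q k) (hq k) s (half_pos hκ)) hd

/-- ★ **RUN A's SIZES ON A ℤ⁴ LATTICE GIVE (UD) — geometry discharged**: a three-factor read-out of `Π_{k+1,μν}(g; ·)` over an injectively read lattice `q k : β k ↪ ℤ⁴` with sizes
`sA, sC, sB` and ℓ¹ decay `κ > 0` through the positions (read positions at separation `≥ |z|₁`) gives node U3's decay slot with a k-UNIFORM constant:
`DecayBound (EA F ℰ ρ bV) (Window γ) (sA·sC·sB·K₁(4, κ∕2)²) (κ∕2)` (FILE 1's `decayBound_EA_of_threeFactorSizes`, lattice sums by §7).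
[cite: King1986, (4.41) p.675; Balaban1987RG1, (1.18) p.263 and (5.10) p.293] -/
theorem decayBound_EA_of_threeFactorSizes_zlattice
    (q : (k : ℕ) → β k → (Fin 4 → ℤ)) (hq : ∀ k, Function.Injective (q k)) (p r : (k : ℕ) → Fin 4 → Fin 4 → (Fin 4 → ℤ) → (Fin 4 → ℤ))
    (uA vA : (ℕ → ℝ) → (k : ℕ) → Fin 4 → Fin 4 → (Fin 4 → ℤ) → β k → ℝ)
    (CA : (ℕ → ℝ) → (k : ℕ) → Fin 4 → Fin 4 → (Fin 4 → ℤ) → Matrix (β k) (β k) ℝ)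
    {γ κ sA sC sB : ℝ} (hκ : 0 < κ) (hsA : 0 ≤ sA) (hsC : 0 ≤ sC) (hsB : 0 ≤ sB)
    (hEA : ∀ g ∈ Window γ, ∀ (k : ℕ) (μ ν : Fin 4) (z : Fin 4 → ℤ),
      kernelA F ℰ ρ bV g k μ ν z = uA g k μ ν z ⬝ᵥ (CA g k μ ν z *ᵥ vA g k μ ν z))
    (hu : ∀ g ∈ Window γ, ∀ (k : ℕ) (μ ν : Fin 4) (z : Fin 4 → ℤ) (i : β k),
      |uA g k μ ν z i| ≤ sA * Real.exp (-(κ * l1 (p k μ ν z - q k i))))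
    (hCA : ∀ g ∈ Window γ, ∀ (k : ℕ) (μ ν : Fin 4) (z : Fin 4 → ℤ) (i i' : β k),
      |CA g k μ ν z i i'| ≤ sC * Real.exp (-(κ * l1 (q k i - q k i'))))
    (hvA : ∀ g ∈ Window γ, ∀ (k : ℕ) (μ ν : Fin 4) (z : Fin 4 → ℤ) (i' : β k),
      |vA g k μ ν z i'| ≤ sB * Real.exp (-(κ * l1 (q k i' - r k μ ν z))))
    (hd : ∀ (k : ℕ) (μ ν : Fin 4) (z : Fin 4 → ℤ), l1 z ≤ l1 (p k μ ν z - r k μ ν z)) :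
    DecayBound (EA F ℰ ρ bV) (Window γ) (sA * sC * sB * K₁ 4 (κ / 2) ^ 2) (κ / 2) :=
  decayBound_EA_of_threeFactorSizes F ℰ ρ bV (P := fun _ => Fin 4 → ℤ) (fun _ x y => l1 (x - y)) (fun _ _ _ => l1_nonneg _)
    (fun _ x y w => l1_sub_triangle x y w) q p r uA vA CA hκ.le hsA hsC hsB hEA hu hCA hvA
    (fun k s => sum_exp_neg_l1_sub_le_K₁_of_injective (q k) (hq k) s (half_pos hκ)) hd

/-- **… HENCE THE (5.10) CLASS LETTER ON A ℤ⁴ LATTICE**: `KernelDecay F ℰ ρ bV (Window γ) μ ν (κ∕2)` at every direction pair from run A's sizes alone — W1-19's run-A decay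
clause, the `hdec` input of the (D4) read-out at the kernel objects. [cite: Balaban1987RG1, (5.10) p.293; King1986, (4.41) p.675] -/
theorem kernelDecay_of_threeFactorSizes_zlattice
    (q : (k : ℕ) → β k → (Fin 4 → ℤ)) (hq : ∀ k, Function.Injective (q k)) (p r : (k : ℕ) → Fin 4 → Fin 4 → (Fin 4 → ℤ) → (Fin 4 → ℤ))
    (uA vA : (ℕ → ℝ) → (k : ℕ) → Fin 4 → Fin 4 → (Fin 4 → ℤ) → β k → ℝ)
    (CA : (ℕ → ℝ) → (k : ℕ) → Fin 4 → Fin 4 → (Fin 4 → ℤ) → Matrix (β k) (β k) ℝ)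
    {γ κ sA sC sB : ℝ} (hκ : 0 < κ) (hsA : 0 ≤ sA) (hsC : 0 ≤ sC) (hsB : 0 ≤ sB)
    (hEA : ∀ g ∈ Window γ, ∀ (k : ℕ) (μ ν : Fin 4) (z : Fin 4 → ℤ),
      kernelA F ℰ ρ bV g k μ ν z = uA g k μ ν z ⬝ᵥ (CA g k μ ν z *ᵥ vA g k μ ν z))
    (hu : ∀ g ∈ Window γ, ∀ (k : ℕ) (μ ν : Fin 4) (z : Fin 4 → ℤ) (i : β k),
      |uA g k μ ν z i| ≤ sA * Real.exp (-(κ * l1 (p k μ ν z - q k i))))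
    (hCA : ∀ g ∈ Window γ, ∀ (k : ℕ) (μ ν : Fin 4) (z : Fin 4 → ℤ) (i i' : β k),
      |CA g k μ ν z i i'| ≤ sC * Real.exp (-(κ * l1 (q k i - q k i'))))
    (hvA : ∀ g ∈ Window γ, ∀ (k : ℕ) (μ ν : Fin 4) (z : Fin 4 → ℤ) (i' : β k),
      |vA g k μ ν z i'| ≤ sB * Real.exp (-(κ * l1 (q k i' - r k μ ν z))))
    (hd : ∀ (k : ℕ) (μ ν : Fin 4) (z : Fin 4 → ℤ), l1 z ≤ l1 (p k μ ν z - r k μ ν z)) (μ ν : Fin 4) :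
    KernelDecay F ℰ ρ bV (Window γ) μ ν (κ / 2) :=
  kernelDecay_of_threeFactorSizes F ℰ ρ bV (P := fun _ => Fin 4 → ℤ) (fun _ x y => l1 (x - y)) (fun _ _ _ => l1_nonneg _)
    (fun _ x y w => l1_sub_triangle x y w) q p r uA vA CA hκ.le hsA hsC hsB hEA hu hCA hvA
    (fun k s => sum_exp_neg_l1_sub_le_K₁_of_injective (q k) (hq k) s (half_pos hκ)) hd μ ν

/-! ## §9 A2 calibration: the two letters inhabit every row of §8 at the one-point lattice, and the mechanism hands the letter back at rate `κ∕2` -/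

/-- ★ **A2 CALIBRATION OF THE MECHANISM's ROWS AGAINST THE LETTERS** (№189 hygiene for FILE 1 §2; referee ref-Q READ-9 (N2)).  Every term family `ℰ` carrying the (UD) letter
`DecayBound (EA F ℰ ρ bV) (Window γ) E₀ κ` (`E₀ ≥ 0`, `κ > 0`) and the N18 letter `KernelStepRate F ℰ ρ bV γ κ θ₅ C₅` (`θ₅, C₅ ≥ 0`) INHABITS ALL ROWS of
`kernelStepRate_of_threeFactorRates_zlattice` — NON-VACUOUSLY, by its own kernels: one-point lattice `β k = Unit` read at the origin, read positions `p = z`, `r = 0`, row factor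
`u_A = Π_{k+1}(g; z)` ∕ `u_B = Π_{k+2}(b, g; z)`, middle and column `E = v = 1`, sizes `(E₀, 1, 1)`, one-line rates `(C₅, 0, 0)` — and the mechanism then RETURNS
`KernelStepRate F ℰ ρ bV γ (κ∕2) θ₅ (C₅·K₁(4, κ∕2)²)`.  So the three-factor rows are jointly satisfiable by non-zero kernels exactly when {(UD), the N18 letter} hold (up to
`κ ↦ κ∕2` and constants): the located cost of the King-mechanism road for Bałaban's (1.21) kernels is the factorisation WITH k-UNIFORM SIZES, not the geometry.  The proof term IS
the inhabitant (each row in one line). [cite: King1986, Prop. 3.9 (3.73) p.665 and (4.42)–(4.43) p.675; Balaban1987RG1, Thm 1 p.259, (1.18) p.263 and (1.20)–(1.22) p.264] -/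
theorem kernelStepRate_of_letters_via_threeFactorRows {γ κ θ₅ C₅ E₀ : ℝ} (hκ : 0 < κ) (hθ : 0 ≤ θ₅) (hC₅ : 0 ≤ C₅) (hE₀ : 0 ≤ E₀)
    (hUD : DecayBound (EA F ℰ ρ bV) (Window γ) E₀ κ) (h18 : KernelStepRate F ℰ ρ bV γ κ θ₅ C₅) :
    KernelStepRate F ℰ ρ bV γ (κ / 2) θ₅ (C₅ * K₁ 4 (κ / 2) ^ 2) := by
  have hdec := (decayBound_EA_iff F ℰ ρ bV (Window γ) E₀ κ).1 hUD
  have hl0 : l1 ((0 : Fin 4 → ℤ) - 0) = 0 := by simp [B12Sec2to5.l1]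
  have h := kernelStepRate_of_threeFactorRates_zlattice F ℰ ρ bV (β := fun _ => Unit)
    (fun _ _ => (0 : Fin 4 → ℤ)) (fun _ => Function.injective_of_subsingleton _) (fun _ _ _ z => z) (fun _ _ _ _ => 0)
    (fun g k μ ν z _ => kernelA F ℰ ρ bV g k μ ν z) (fun _ _ _ _ _ _ => (1 : ℝ)) (fun _ _ _ _ _ => fun _ _ => (1 : ℝ))
    (fun b g k μ ν z _ => kernelA F ℰ ρ bV (prependCoupling b g) (k + 1) μ ν z) (fun _ _ _ _ _ _ _ => (1 : ℝ))
    (fun _ _ _ _ _ _ => fun _ _ => (1 : ℝ))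
    (sA := E₀) (sC := 1) (sB := 1) (cA := C₅) (cC := 0) (cB := 0) hκ hθ hE₀ zero_le_one zero_le_one hC₅ le_rfl le_rfl
    (fun g _ k μ ν z => by simp [dotProduct, Matrix.mulVec])
    (fun b _ _ g _ k μ ν z => by simp [dotProduct, Matrix.mulVec])
    (fun g hg k μ ν z _ => by
      rw [sub_zero, ← neg_mul]
      exact hdec g hg k μ ν z)
    (fun g _ k μ ν z _ _ => by rw [hl0, mul_zero, neg_zero, Real.exp_zero, mul_one, abs_one])
    (fun b _ _ g _ k μ ν z _ _ => by rw [hl0, mul_zero, neg_zero, Real.exp_zero, mul_one, abs_one])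
    (fun b _ _ g _ k μ ν z _ => by rw [hl0, mul_zero, neg_zero, Real.exp_zero, mul_one, abs_one])
    (fun b hb hbγ g hg k μ ν z _ => by
      rw [sub_zero, abs_sub_comm]
      exact h18 b hb hbγ g hg k μ ν z)
    (fun b _ _ g _ k μ ν z _ _ => by rw [sub_self, abs_zero, zero_mul, zero_mul])
    (fun b _ _ g _ k μ ν z _ => by rw [sub_self, abs_zero, zero_mul, zero_mul])
    (fun k μ ν z => by rw [sub_zero])
  convert h using 2
  ring

end ZLattice

/-! ## §10 At the record: FILE 2's `…OfRecord₁₃` editions on ℤ⁴ lattices -/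

section Record

open scoped Matrix.Norms.L2Operator

variable (F : T4Family) (N : ℕ) [NeZero N]
variable {β : ℕ → Type*} [∀ k, Fintype (β k)]

/-- **THE RECORD's N18 LETTER FROM THE MECHANISM ON ℤ⁴ LATTICES**: at the Stage-13 parameters `θ` and the letter block `ℓ`, a three-factor representation of the record's kernel
functionals `(objectsOfRecord₁₃ F N θ ℓ).EA ∕ .EB` over injectively read ℤ⁴ lattices with sizes, ONE-LINE RATES and ℓ¹ decay `κ > 0` through positions (read positions at separation
`≥ |z|₁`) on `]0, θ.γ]^ℕ` gives `KernelStepRateOfRecord₁₃ F N θ (κ∕2) θ₅ ((cA·sC·sB + sA·cC·sB + sA·sC·cB)·K₁(4, κ∕2)²)` — FILE 2's `kernelStepRateOfRecord₁₃_of_threeFactorRates`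
with the geometric rows discharged (the letter the v5 pin's N18 conjunct costs, dag-n18-w1 `n18At_rateCarriers_of_kernels_pin_iff_letter`).
[cite: King1986, Prop. 3.9 (3.73) p.665 and (4.42)–(4.43) p.675; Balaban1987RG1, Thm 1 p.259, (1.20)–(1.22) p.264 and (5.10) p.293] -/
theorem kernelStepRateOfRecord₁₃_of_threeFactorRates_zlattice (θ : Stage13Params F N) (ℓ : U3Letters₁₁)
    (q : (k : ℕ) → β k → (Fin 4 → ℤ)) (hq : ∀ k, Function.Injective (q k)) (p r : (k : ℕ) → Fin 4 → Fin 4 → (Fin 4 → ℤ) → (Fin 4 → ℤ))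
    (uA vA : (ℕ → ℝ) → (k : ℕ) → Fin 4 → Fin 4 → (Fin 4 → ℤ) → β k → ℝ)
    (CA : (ℕ → ℝ) → (k : ℕ) → Fin 4 → Fin 4 → (Fin 4 → ℤ) → Matrix (β k) (β k) ℝ)
    (uB vB : ℝ → (ℕ → ℝ) → (k : ℕ) → Fin 4 → Fin 4 → (Fin 4 → ℤ) → β k → ℝ)
    (CB : ℝ → (ℕ → ℝ) → (k : ℕ) → Fin 4 → Fin 4 → (Fin 4 → ℤ) → Matrix (β k) (β k) ℝ)
    {κ θ₅ sA sC sB cA cC cB : ℝ} (hκ : 0 < κ) (hθ : 0 ≤ θ₅) (hsA : 0 ≤ sA) (hsC : 0 ≤ sC) (hsB : 0 ≤ sB)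
    (hcA : 0 ≤ cA) (hcC : 0 ≤ cC) (hcB : 0 ≤ cB)
    (hEA : ∀ g ∈ Window θ.γ, ∀ (k : ℕ) (μ ν : Fin 4) (z : Fin 4 → ℤ),
      (objectsOfRecord₁₃ F N θ ℓ).EA k g PUnit.unit (pt k μ ν z) = uA g k μ ν z ⬝ᵥ (CA g k μ ν z *ᵥ vA g k μ ν z))
    (hEB : ∀ b : ℝ, 0 < b → b ≤ θ.γ → ∀ g ∈ Window θ.γ, ∀ (k : ℕ) (μ ν : Fin 4) (z : Fin 4 → ℤ),
      (objectsOfRecord₁₃ F N θ ℓ).EB k b g (bg k μ ν z) (pt k μ ν z) = uB b g k μ ν z ⬝ᵥ (CB b g k μ ν z *ᵥ vB b g k μ ν z))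
    (hu : ∀ g ∈ Window θ.γ, ∀ (k : ℕ) (μ ν : Fin 4) (z : Fin 4 → ℤ) (i : β k),
      |uA g k μ ν z i| ≤ sA * Real.exp (-(κ * l1 (p k μ ν z - q k i))))
    (hCA : ∀ g ∈ Window θ.γ, ∀ (k : ℕ) (μ ν : Fin 4) (z : Fin 4 → ℤ) (i i' : β k),
      |CA g k μ ν z i i'| ≤ sC * Real.exp (-(κ * l1 (q k i - q k i'))))
    (hCB : ∀ b : ℝ, 0 < b → b ≤ θ.γ → ∀ g ∈ Window θ.γ, ∀ (k : ℕ) (μ ν : Fin 4) (z : Fin 4 → ℤ) (i i' : β k),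
      |CB b g k μ ν z i i'| ≤ sC * Real.exp (-(κ * l1 (q k i - q k i'))))
    (hv : ∀ b : ℝ, 0 < b → b ≤ θ.γ → ∀ g ∈ Window θ.γ, ∀ (k : ℕ) (μ ν : Fin 4) (z : Fin 4 → ℤ) (i' : β k),
      |vB b g k μ ν z i'| ≤ sB * Real.exp (-(κ * l1 (q k i' - r k μ ν z))))
    (hdu : ∀ b : ℝ, 0 < b → b ≤ θ.γ → ∀ g ∈ Window θ.γ, ∀ (k : ℕ) (μ ν : Fin 4) (z : Fin 4 → ℤ) (i : β k),
      |uB b g k μ ν z i - uA g k μ ν z i| ≤ cA * θ₅ ^ (k + 1) * Real.exp (-(κ * l1 (p k μ ν z - q k i))))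
    (hdC : ∀ b : ℝ, 0 < b → b ≤ θ.γ → ∀ g ∈ Window θ.γ, ∀ (k : ℕ) (μ ν : Fin 4) (z : Fin 4 → ℤ) (i i' : β k),
      |CB b g k μ ν z i i' - CA g k μ ν z i i'| ≤ cC * θ₅ ^ (k + 1) * Real.exp (-(κ * l1 (q k i - q k i'))))
    (hdv : ∀ b : ℝ, 0 < b → b ≤ θ.γ → ∀ g ∈ Window θ.γ, ∀ (k : ℕ) (μ ν : Fin 4) (z : Fin 4 → ℤ) (i' : β k),
      |vB b g k μ ν z i' - vA g k μ ν z i'| ≤ cB * θ₅ ^ (k + 1) * Real.exp (-(κ * l1 (q k i' - r k μ ν z))))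
    (hd : ∀ (k : ℕ) (μ ν : Fin 4) (z : Fin 4 → ℤ), l1 z ≤ l1 (p k μ ν z - r k μ ν z)) :
    KernelStepRateOfRecord₁₃ F N θ (κ / 2) θ₅ ((cA * sC * sB + sA * cC * sB + sA * sC * cB) * K₁ 4 (κ / 2) ^ 2) :=
  kernelStepRateOfRecord₁₃_of_threeFactorRates F N θ ℓ (P := fun _ => Fin 4 → ℤ) (fun _ x y => l1 (x - y)) (fun _ _ _ => l1_nonneg _)
    (fun _ x y w => l1_sub_triangle x y w) q p r uA vA CA uB vB CB hκ.le hθ hsA hsC hsB hcA hcC hcB hEA hEB hu hCA hCB hv hdu hdC hdv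
    (fun k s => sum_exp_neg_l1_sub_le_K₁_of_injective (q k) (hq k) s (half_pos hκ)) hd

/-- **THE RECORD's (5.10) CLASS LETTER FROM RUN A's SIZES ON ℤ⁴ LATTICES**: `KernelDecayOfRecord₁₃ F N θ μ ν (κ∕2)` at every direction pair — FILE 2's
`kernelDecayOfRecord₁₃_of_threeFactorSizes` with the geometric rows discharged (the `hdec` row of the (D4) read-out at the record, dag-n27-w1 `readOutAt_objectsOfRecord₁₃_coPH`).
[cite: Balaban1987RG1, (5.10) p.293; King1986, (4.41) p.675] -/
theorem kernelDecayOfRecord₁₃_of_threeFactorSizes_zlattice (θ : Stage13Params F N) (ℓ : U3Letters₁₁)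
    (q : (k : ℕ) → β k → (Fin 4 → ℤ)) (hq : ∀ k, Function.Injective (q k)) (p r : (k : ℕ) → Fin 4 → Fin 4 → (Fin 4 → ℤ) → (Fin 4 → ℤ))
    (uA vA : (ℕ → ℝ) → (k : ℕ) → Fin 4 → Fin 4 → (Fin 4 → ℤ) → β k → ℝ)
    (CA : (ℕ → ℝ) → (k : ℕ) → Fin 4 → Fin 4 → (Fin 4 → ℤ) → Matrix (β k) (β k) ℝ)
    {κ sA sC sB : ℝ} (hκ : 0 < κ) (hsA : 0 ≤ sA) (hsC : 0 ≤ sC) (hsB : 0 ≤ sB)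
    (hEA : ∀ g ∈ Window θ.γ, ∀ (k : ℕ) (μ ν : Fin 4) (z : Fin 4 → ℤ),
      (objectsOfRecord₁₃ F N θ ℓ).EA k g PUnit.unit (pt k μ ν z) = uA g k μ ν z ⬝ᵥ (CA g k μ ν z *ᵥ vA g k μ ν z))
    (hu : ∀ g ∈ Window θ.γ, ∀ (k : ℕ) (μ ν : Fin 4) (z : Fin 4 → ℤ) (i : β k),
      |uA g k μ ν z i| ≤ sA * Real.exp (-(κ * l1 (p k μ ν z - q k i))))
    (hCA : ∀ g ∈ Window θ.γ, ∀ (k : ℕ) (μ ν : Fin 4) (z : Fin 4 → ℤ) (i i' : β k),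
      |CA g k μ ν z i i'| ≤ sC * Real.exp (-(κ * l1 (q k i - q k i'))))
    (hvA : ∀ g ∈ Window θ.γ, ∀ (k : ℕ) (μ ν : Fin 4) (z : Fin 4 → ℤ) (i' : β k),
      |vA g k μ ν z i'| ≤ sB * Real.exp (-(κ * l1 (q k i' - r k μ ν z))))
    (hd : ∀ (k : ℕ) (μ ν : Fin 4) (z : Fin 4 → ℤ), l1 z ≤ l1 (p k μ ν z - r k μ ν z)) (μ ν : Fin 4) :
    KernelDecayOfRecord₁₃ F N θ μ ν (κ / 2) :=
  kernelDecayOfRecord₁₃_of_threeFactorSizes F N θ ℓ (P := fun _ => Fin 4 → ℤ) (fun _ x y => l1 (x - y)) (fun _ _ _ => l1_nonneg _)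
    (fun _ x y w => l1_sub_triangle x y w) q p r uA vA CA hκ.le hsA hsC hsB hEA hu hCA hvA
    (fun k s => sum_exp_neg_l1_sub_le_K₁_of_injective (q k) (hq k) s (half_pos hκ)) hd μ ν

end Record

end YMDAG.N18.KernelStepRateKingMechanism

end
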